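import Mathlib
import Literature.NumberTheory.Transcendental.BakerLogarithmsAuxiliary
import HarnessLib

/-!
# Baker's theorem — the number field of the set-up: Lemma 3 (arithmetic half) and Lemma 2

Trunk T-TRANSCEND, family `periods`, fact `Literature.NumberTheory.Transcendental.baker` (**periods.S13**); sequel to
`BakerLogarithmsAuxiliary.lean` (the auxiliary function `F p m` of a `Setup` in closed form).
Source: A. Baker, *Transcendental Number Theory* (1975), Ch. 2, Lemma 2 (p. 21) and Lemma 3
(pp. 22–23).

For a `Setup` `S` (a normalised counterexample (1), p. 19) we introduce the number field
`K = ℚ(α₀, …, αₙ, β₀, β₀', …)` generated by the algebraic data (`Setup.K`, an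
`IntermediateField ℚ ℂ`, a `NumberField`), a common denominator `D` (`Setup.D`, Baker's leading
coefficients in (2), p. 20), a bound `M` for all conjugates of the generators, an integral basis
`bO` of `𝓞 K` indexed by the embeddings `K →+* ℂ`, and the constant `c_K` bounding integral
coordinates by the house (Mathlib's `NumberField.house.basis_repr_norm_le_const_mul_house`).
Baker expands in the power basis `α^s β^t` with `s, t < d` (his (2) and the `A(s,t)` of p. 21);
an integral basis of `K` serves the same purpose and its size `[K:ℚ] = h` replaces his `d^{2n}`.

Main results (all proved):
* `Setup.F_nat_eq`: `f_m(l) = P_m · G` with `P_m = ∏ (log αᵣ)^{mᵣ}` and `G ∈ K`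
  (the display on p. 22), and `Setup.isIntegral_D_pow_mul_termK`: `D^e G`-terms are algebraic
  integers, `e = |m| + (n+1) L l` (Baker's `P'`, eq. (6));
* `Setup.norm_P_le_norm_F_mul` — **Lemma 3, second assertion**: if `f_m(l) ≠ 0` then
  `|P_m| ≤ |f_m(l)| · |D|^e · H^{h-1}` with an explicit `H` (the source: "either `f(l) = 0` or
  `|f(l)| > c₆^{-h²-Ll}`", proved there by taking the norm of the algebraic integer `f'`; here via
  `1 ≤ |x| · house(x)^{h-1}`, `Setup.one_le_norm_mul_house_pow`);
* `Setup.lemma2` — **Lemma 2** for general parameters `L, P₀, D₀`: if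
  `2 P₀ (D₀+1)^{n+1} h ≤ (L+1)^{n+2}` there are integers `p(λ)`, not all zero, explicitly
  bounded, with `f_m(l) = 0` for `1 ≤ l ≤ P₀` and all `mᵢ ≤ D₀` — from Siegel's lemma
  (Mathlib's `Int.Matrix.exists_ne_zero_int_vec_norm_le`, i.e. Lemma 1) applied to the integer
  coordinates of the algebraic integers `D^{e₀} · termK` in the basis `bO`.

The choice of parameters (the source's `h`, `L = [h^{2-1/(4n)}]`), the extrapolation
(Lemmas 4–5) and §5 follow in sequels.

## References

* [Baker1975] A. Baker, *Transcendental Number Theory*, Cambridge Univ. Press, 1975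
  (doi:10.1017/cbo9780511565977), Ch. 2, Lemmas 2–3, pp. 20–23.
-/

noncomputable section

open Complex Finset NumberField

namespace Literature.NumberTheory.Transcendental.Baker1975

/-! ### The algebraic part of a term, evaluated at arbitrary conjugates -/

/-- The algebraic part of one term of `f_m(l)` with the generators `αᵢ, β₀, βᵣ` replaced by
arbitrary complex numbers `aᵢ, b₀, bᵣ` (used for the conjugates of `f'`, Baker 1975, p. 23):
`Q(m₀, λ₀, λ_N b₀, l) · ∏ᵣ (λᵣ + λ_N bᵣ)^{mᵣ} · ∏ᵢ aᵢ^{λᵢ l}`. [cite: Baker1975, Ch. 2 Lemma 3] -/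
def termEval (n L : ℕ) (a : Fin (n + 1) → ℂ) (b₀ : ℂ) (b : Fin n → ℂ) (u : Idx n L)
    (m : Fin (n + 1) → ℕ) (l : ℕ) : ℂ :=
  Q (m 0) (u.1 : ℕ) (((u.2 (Fin.last n) : ℕ) : ℂ) * b₀) (l : ℂ) *
    (∏ r : Fin n, ((((u.2 (Fin.castSucc r)) : ℕ) : ℂ) + ((u.2 (Fin.last n) : ℕ) : ℂ) * b r) ^
      m r.succ) *
    ∏ i, a i ^ ((u.2 i : ℕ) * l)

/-- **Size of the conjugates** (Baker 1975, p. 23: "any conjugate of `f'` … has absolute value at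
most `c₁₀^{h²+Ll}`"): if `M ≥ 1` bounds `|aᵢ|, |b₀|, |bᵣ|` and `l ≥ 1` then
`|termEval| ≤ (2LM)^{|m|} l^L M^{(n+1)Ll}`. [cite: Baker1975, Ch. 2 Lemma 3] -/
theorem norm_termEval_le {n L : ℕ} {a : Fin (n + 1) → ℂ} {b₀ : ℂ} {b : Fin n → ℂ} {M : ℝ}
    (hM : 1 ≤ M) (ha : ∀ i, ‖a i‖ ≤ M) (hb₀ : ‖b₀‖ ≤ M) (hb : ∀ r, ‖b r‖ ≤ M) (u : Idx n L)
    (m : Fin (n + 1) → ℕ) {l : ℕ} (hl : 1 ≤ l) :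
    ‖termEval n L a b₀ b u m l‖ ≤
      (2 * L * M) ^ (∑ i, m i) * (l : ℝ) ^ L * M ^ ((n + 1) * (L * l)) := by
  have hL0 : (0 : ℝ) ≤ L := Nat.cast_nonneg _
  have hl1 : (1 : ℝ) ≤ l := by exact_mod_cast hl
  have hlam : ∀ i, ((u.2 i : ℕ) : ℝ) ≤ L := fun i => by exact_mod_cast Nat.lt_succ_iff.mp (u.2 i).isLt
  have hlam0 : ((u.1 : ℕ) : ℝ) ≤ L := by exact_mod_cast Nat.lt_succ_iff.mp u.1.isLt
  have hLM : (L : ℝ) ≤ L * M := le_mul_of_one_le_right hL0 hM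
  -- the polynomial factor
  have hQ : ‖Q (m 0) (u.1 : ℕ) (((u.2 (Fin.last n) : ℕ) : ℂ) * b₀) (l : ℂ)‖ ≤
      (2 * L * M) ^ m 0 * (l : ℝ) ^ L := by
    refine (norm_Q_le _ _ _ _).trans ?_
    have h1 : ((u.1 : ℕ) : ℝ) + ‖((u.2 (Fin.last n) : ℕ) : ℂ) * b₀‖ ≤ 2 * L * M := by
      rw [norm_mul, Complex.norm_natCast]
      have : ((u.2 (Fin.last n) : ℕ) : ℝ) * ‖b₀‖ ≤ L * M :=
        mul_le_mul (hlam _) hb₀ (norm_nonneg _) hL0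
      linarith
    have h2 : max 1 ‖(l : ℂ)‖ ^ (u.1 : ℕ) ≤ (l : ℝ) ^ L := by
      rw [Complex.norm_natCast, max_eq_right hl1]
      exact pow_le_pow_right₀ hl1 (Nat.lt_succ_iff.mp u.1.isLt)
    exact mul_le_mul (pow_le_pow_left₀ (by positivity) h1 _) h2 (by positivity) (by positivity)
  -- the `γ` factor
  have hγ : ‖∏ r : Fin n, ((((u.2 (Fin.castSucc r)) : ℕ) : ℂ) +
      ((u.2 (Fin.last n) : ℕ) : ℂ) * b r) ^ m r.succ‖ ≤ (2 * L * M) ^ (∑ r : Fin n, m r.succ) := by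
    rw [norm_prod, ← prod_pow_eq_pow_sum]
    refine prod_le_prod (fun r _ => norm_nonneg _) fun r _ => ?_
    rw [norm_pow]
    refine pow_le_pow_left₀ (norm_nonneg _) ((norm_add_le _ _).trans ?_) _
    rw [norm_mul, Complex.norm_natCast, Complex.norm_natCast]
    have : ((u.2 (Fin.last n) : ℕ) : ℝ) * ‖b r‖ ≤ L * M :=
      mul_le_mul (hlam _) (hb r) (norm_nonneg _) hL0
    linarith [hlam (Fin.castSucc r)]
  -- the `α` factor
  have hα : ‖∏ i, a i ^ ((u.2 i : ℕ) * l)‖ ≤ M ^ ((n + 1) * (L * l)) := by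
    rw [norm_prod]
    calc ∏ i, ‖a i ^ ((u.2 i : ℕ) * l)‖ ≤ ∏ _i : Fin (n + 1), M ^ (L * l) := by
          refine prod_le_prod (fun i _ => norm_nonneg _) fun i _ => ?_
          rw [norm_pow]
          calc ‖a i‖ ^ ((u.2 i : ℕ) * l) ≤ (max 1 ‖a i‖) ^ ((u.2 i : ℕ) * l) :=
                pow_le_pow_left₀ (norm_nonneg _) (le_max_right _ _) _
            _ ≤ (max 1 ‖a i‖) ^ (L * l) :=
                pow_le_pow_right₀ (le_max_left _ _)
                  (Nat.mul_le_mul_right _ (Nat.lt_succ_iff.mp (u.2 i).isLt))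
            _ ≤ M ^ (L * l) := pow_le_pow_left₀ (by positivity) (max_le hM (ha i)) _
      _ = M ^ ((n + 1) * (L * l)) := by rw [prod_const, card_univ, Fintype.card_fin, ← pow_mul]; ring_nf
  have hsum : (∑ i, m i) = m 0 + ∑ r : Fin n, m r.succ := Fin.sum_univ_succ m
  calc ‖termEval n L a b₀ b u m l‖
      = ‖Q (m 0) (u.1 : ℕ) (((u.2 (Fin.last n) : ℕ) : ℂ) * b₀) (l : ℂ)‖ *
          ‖∏ r : Fin n, ((((u.2 (Fin.castSucc r)) : ℕ) : ℂ) +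
            ((u.2 (Fin.last n) : ℕ) : ℂ) * b r) ^ m r.succ‖ * ‖∏ i, a i ^ ((u.2 i : ℕ) * l)‖ := by
        rw [termEval, norm_mul, norm_mul]
    _ ≤ (2 * L * M) ^ m 0 * (l : ℝ) ^ L * (2 * L * M) ^ (∑ r : Fin n, m r.succ) *
          M ^ ((n + 1) * (L * l)) := by gcongr
    _ = (2 * L * M) ^ (∑ i, m i) * (l : ℝ) ^ L * M ^ ((n + 1) * (L * l)) := by
        rw [hsum, pow_add]; ring

namespace Setup

variable (S : Setup) {L : ℕ}

/-! ### The number field `K = ℚ(α₀, …, αₙ, β₀, β₀', …)` of the set-up -/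

/-- The generators `α₀, …, αₙ, β₀, β₀', …, β_{n-1}'` of the field of the set-up.
[cite: Baker1975, Ch. 2 §3] -/
def gens : Set ℂ := Set.range S.α ∪ insert S.β₀ (Set.range S.β)

/-- The set of generators is finite. [folklore] -/
theorem gens_finite : S.gens.Finite :=
  (Set.finite_range _).union ((Set.finite_range _).insert _)

/-- The generators are algebraic. [cite: Baker1975, Ch. 2 §3] -/
theorem isAlgebraic_of_mem_gens {x : ℂ} (hx : x ∈ S.gens) : IsAlgebraic ℚ x := by
  rcases hx with ⟨i, rfl⟩ | hx
  · exact S.isAlgebraic_exp i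
  · rcases Set.mem_insert_iff.mp hx with rfl | ⟨r, rfl⟩
    · exact S.isAlgebraic_β₀
    · exact S.isAlgebraic_β r

/-- The number field `K = ℚ(α₁, …, αₙ, β₀, …, β_{n-1})` in which Baker's `f'` lives (Baker 1975,
p. 23: "an algebraic integer with degree at most `d^{2n}`"). [cite: Baker1975, Ch. 2 Lemma 3] -/
def K : IntermediateField ℚ ℂ := IntermediateField.adjoin ℚ S.gens

/-- `K/ℚ` is finite. [folklore] -/
instance finiteDimensional_K : FiniteDimensional ℚ S.K := by
  haveI : Finite S.gens := S.gens_finite.to_subtype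
  exact IntermediateField.finiteDimensional_adjoin fun x hx =>
    (S.isAlgebraic_of_mem_gens hx).isIntegral

/-- `K` is a number field. [folklore] -/
instance numberField_K : NumberField S.K :=
  { to_charZero := charZero_of_injective_algebraMap (algebraMap ℚ S.K).injective
    to_finiteDimensional := S.finiteDimensional_K }

/-- The generators lie in `K`. [folklore] -/
theorem mem_K_of_mem_gens {x : ℂ} (hx : x ∈ S.gens) : x ∈ S.K :=
  IntermediateField.subset_adjoin _ _ hx

/-- `αᵢ` as an element of `K`. [cite: Baker1975, Ch. 2 §3] -/
def αK (i : Fin (S.n + 1)) : S.K := ⟨S.α i, S.mem_K_of_mem_gens (Or.inl ⟨i, rfl⟩)⟩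

/-- `β₀` as an element of `K`. [cite: Baker1975, Ch. 2 §3] -/
def β₀K : S.K := ⟨S.β₀, S.mem_K_of_mem_gens (Or.inr (Set.mem_insert _ _))⟩

/-- `βᵣ` as an element of `K`. [cite: Baker1975, Ch. 2 §3] -/
def βK (r : Fin S.n) : S.K := ⟨S.β r, S.mem_K_of_mem_gens (Or.inr (Set.mem_insert_of_mem _ ⟨r, rfl⟩))⟩

/-- `(αK i : ℂ) = αᵢ`. [folklore] -/
@[simp] theorem coe_αK (i : Fin (S.n + 1)) : (S.αK i : ℂ) = S.α i := rfl

/-- `(β₀K : ℂ) = β₀`. [folklore] -/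
@[simp] theorem coe_β₀K : (S.β₀K : ℂ) = S.β₀ := rfl

/-- `(βK r : ℂ) = βᵣ`. [folklore] -/
@[simp] theorem coe_βK (r : Fin S.n) : (S.βK r : ℂ) = S.β r := rfl

/-- The family of all generators, in `K`, indexed by `Fin (n+1) ⊕ Option (Fin n)`
(`inl i ↦ αᵢ`, `inr none ↦ β₀`, `inr (some r) ↦ βᵣ`). [folklore] -/
def genK : Fin (S.n + 1) ⊕ Option (Fin S.n) → S.K
  | Sum.inl i => S.αK i
  | Sum.inr none => S.β₀K
  | Sum.inr (some r) => S.βK r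

/-- **A common denominator** (Baker's leading coefficients `aᵣ, bᵣ`, p. 20): a non-zero integer
`D` with `D αᵢ`, `D β₀`, `D βᵣ` algebraic integers. [cite: Baker1975, Ch. 2 §3, eq. (2)] -/
theorem exists_den : ∃ D : ℤ, D ≠ 0 ∧ ∀ g, IsIntegral ℤ ((D : S.K) * S.genK g) := by
  have h1 : ∀ g, ∃ y : ℤ, y ≠ 0 ∧ IsIntegral ℤ ((y : S.K) * S.genK g) := by
    intro g
    have hQ : IsAlgebraic ℚ (S.genK g) := Algebra.IsAlgebraic.isAlgebraic _
    have hz : IsAlgebraic ℤ (S.genK g) := (IsFractionRing.isAlgebraic_iff ℤ ℚ S.K).mpr hQ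
    obtain ⟨y, hy, hint⟩ := hz.exists_integral_multiple
    exact ⟨y, hy, by simpa [zsmul_eq_mul] using hint⟩
  choose y hy hint using h1
  classical
  refine ⟨∏ g, y g, prod_ne_zero_iff.mpr fun g _ => hy g, fun g => ?_⟩
  rw [← mul_prod_erase univ y (mem_univ g)]
  push_cast
  rw [mul_comm ((y g : S.K)) _, mul_assoc]
  have h2 : IsIntegral ℤ (((∏ j ∈ univ.erase g, y j : ℤ) : S.K)) := by
    exact_mod_cast isIntegral_algebraMap (R := ℤ) (A := S.K) (x := ∏ j ∈ univ.erase g, y j)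
  simpa using h2.mul (hint g)

/-- The common denominator `D ≠ 0` of the generators. [cite: Baker1975, Ch. 2 §3, eq. (2)] -/
def D : ℤ := S.exists_den.choose

/-- `D ≠ 0`. [folklore] -/
theorem D_ne_zero : S.D ≠ 0 := S.exists_den.choose_spec.1

/-- `D · g` is an algebraic integer for every generator `g`. [folklore] -/
theorem isIntegral_D_mul_genK (g : Fin (S.n + 1) ⊕ Option (Fin S.n)) :
    IsIntegral ℤ ((S.D : S.K) * S.genK g) :=
  S.exists_den.choose_spec.2 g

/-- `D αᵢ` is an algebraic integer. [folklore] -/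
theorem isIntegral_D_mul_αK (i : Fin (S.n + 1)) : IsIntegral ℤ ((S.D : S.K) * S.αK i) :=
  S.isIntegral_D_mul_genK (Sum.inl i)

/-- `D β₀` is an algebraic integer. [folklore] -/
theorem isIntegral_D_mul_β₀K : IsIntegral ℤ ((S.D : S.K) * S.β₀K) :=
  S.isIntegral_D_mul_genK (Sum.inr none)

/-- `D βᵣ` is an algebraic integer. [folklore] -/
theorem isIntegral_D_mul_βK (r : Fin S.n) : IsIntegral ℤ ((S.D : S.K) * S.βK r) :=
  S.isIntegral_D_mul_genK (Sum.inr (some r))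

/-- `1 ≤ |D|`. [folklore] -/
theorem one_le_abs_D : (1 : ℝ) ≤ |(S.D : ℝ)| := by exact_mod_cast Int.one_le_abs S.D_ne_zero

/-- **A bound for the conjugates of the generators**: `M = 1 + ∑_σ ∑_g |σ g| ≥ 1`.
[cite: Baker1975, Ch. 2 Lemma 3] -/
def M : ℝ := 1 + ∑ σ : S.K →+* ℂ, ∑ g, ‖σ (S.genK g)‖

/-- `1 ≤ M`. [folklore] -/
theorem one_le_M : 1 ≤ S.M := by
  have : 0 ≤ ∑ σ : S.K →+* ℂ, ∑ g, ‖σ (S.genK g)‖ := by positivity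
  unfold M; linarith

/-- Every conjugate of every generator has absolute value at most `M`. [folklore] -/
theorem norm_embedding_genK_le (σ : S.K →+* ℂ) (g : Fin (S.n + 1) ⊕ Option (Fin S.n)) :
    ‖σ (S.genK g)‖ ≤ S.M := by
  have h1 : ‖σ (S.genK g)‖ ≤ ∑ g', ‖σ (S.genK g')‖ :=
    single_le_sum (f := fun g' => ‖σ (S.genK g')‖) (fun _ _ => norm_nonneg _) (mem_univ g)
  have h2 : ∑ g', ‖σ (S.genK g')‖ ≤ ∑ τ : S.K →+* ℂ, ∑ g', ‖τ (S.genK g')‖ :=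
    single_le_sum (f := fun τ : S.K →+* ℂ => ∑ g', ‖τ (S.genK g')‖) (fun _ _ => by positivity)
      (mem_univ σ)
  unfold M; linarith

/-- `|σ αᵢ| ≤ M`. [folklore] -/
theorem norm_embedding_αK_le (σ : S.K →+* ℂ) (i : Fin (S.n + 1)) : ‖σ (S.αK i)‖ ≤ S.M :=
  S.norm_embedding_genK_le σ (Sum.inl i)

/-- `|σ β₀| ≤ M`. [folklore] -/
theorem norm_embedding_β₀K_le (σ : S.K →+* ℂ) : ‖σ S.β₀K‖ ≤ S.M :=
  S.norm_embedding_genK_le σ (Sum.inr none)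

/-- `|σ βᵣ| ≤ M`. [folklore] -/
theorem norm_embedding_βK_le (σ : S.K →+* ℂ) (r : Fin S.n) : ‖σ (S.βK r)‖ ≤ S.M :=
  S.norm_embedding_genK_le σ (Sum.inr (some r))

/-- The number of complex embeddings of `K` (`= [K : ℚ]`, Baker's degree bound `d^{2n}`).
[cite: Baker1975, Ch. 2 Lemma 3] -/
def h : ℕ := Fintype.card (S.K →+* ℂ)

/-- `1 ≤ h`. [folklore] -/
theorem one_le_h : 1 ≤ S.h := Fintype.card_pos

/-! ### Integer coordinates in an integral basis -/

/-- An integral basis of `𝓞 K`, indexed by the embeddings `K → ℂ` (Mathlib's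
`RingOfIntegers.basis` reindexed by `equivReindex`). [folklore] -/
def bO : Module.Basis (S.K →+* ℂ) ℤ (𝓞 S.K) :=
  (RingOfIntegers.basis S.K).reindex (equivReindex S.K).symm

/-- **Coordinates are bounded by the house**: there is `c_K ≥ 1` with
`|coordᵢ(x)| ≤ c_K · house(x)` for every algebraic integer `x` of `K` (Mathlib's
`NumberField.house.basis_repr_norm_le_const_mul_house`). [folklore] -/
theorem exists_cK : ∃ C : ℝ, 1 ≤ C ∧ ∀ (x : 𝓞 S.K) (i : S.K →+* ℂ),
    |((S.bO.repr x i : ℤ) : ℝ)| ≤ C * house (algebraMap (𝓞 S.K) S.K x) := by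
  classical
  obtain ⟨C, hC⟩ : ∃ C : ℝ, ∀ (x : 𝓞 S.K) (i : S.K →+* ℂ),
      ‖((((integralBasis S.K).reindex (equivReindex S.K).symm).repr x i : ℚ) : ℂ)‖ ≤
        C * house (algebraMap (𝓞 S.K) S.K x) :=
    ⟨_, NumberField.house.basis_repr_norm_le_const_mul_house S.K⟩
  refine ⟨max 1 C, le_max_left _ _, fun x i => ?_⟩
  have h1 := hC x i
  have h2 : ((((integralBasis S.K).reindex (equivReindex S.K).symm).repr x i : ℚ) : ℂ) =
      ((S.bO.repr x i : ℤ) : ℂ) := by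
    simp [bO, Module.Basis.repr_reindex, integralBasis_repr_apply]
  rw [h2, Complex.norm_intCast] at h1
  exact h1.trans (mul_le_mul_of_nonneg_right (le_max_right _ _) (house_nonneg _))

/-- The constant `c_K ≥ 1` of `exists_cK`. [folklore] -/
def cK : ℝ := S.exists_cK.choose

/-- `1 ≤ c_K`. [folklore] -/
theorem one_le_cK : 1 ≤ S.cK := S.exists_cK.choose_spec.1

/-- `|coordᵢ(x)| ≤ c_K house(x)`. [folklore] -/
theorem abs_repr_le (x : 𝓞 S.K) (i : S.K →+* ℂ) :
    |((S.bO.repr x i : ℤ) : ℝ)| ≤ S.cK * house (algebraMap (𝓞 S.K) S.K x) :=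
  S.exists_cK.choose_spec.2 x i

/-- `house x ≤ B` from a bound on all conjugates. [folklore] -/
theorem house_le_of_forall_norm_le {x : S.K} {B : ℝ} (hB : 0 ≤ B)
    (h : ∀ σ : S.K →+* ℂ, ‖σ x‖ ≤ B) : house x ≤ B := by
  rw [house, pi_norm_le_iff_of_nonneg hB]
  intro σ
  exact h σ

/-- **The norm inequality** ("the norm of `f'` has absolute value at least 1", Baker 1975,
p. 23): a non-zero algebraic integer `x` of `K` satisfies `1 ≤ |x| · house(x)^{h-1}`.
[cite: Baker1975, Ch. 2 Lemma 3] -/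
theorem one_le_norm_mul_house_pow {x : 𝓞 S.K} (hx : x ≠ 0) :
    1 ≤ ‖((x : S.K) : ℂ)‖ * house (x : S.K) ^ (S.h - 1) := by
  have h0 := NumberField.norm_norm_le_norm_mul_house_pow (x : S.K) (algebraMap S.K ℂ)
  have h1 : (1 : ℝ) ≤ ‖Algebra.norm ℚ (x : S.K)‖ := by
    rw [← Algebra.coe_norm_int]
    have hn : Algebra.norm ℤ x ≠ 0 := Algebra.norm_ne_zero_iff.mpr hx
    rw [Int.norm_cast_rat, Int.norm_eq_abs]
    exact_mod_cast Int.one_le_abs hn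
  have h2 : Module.finrank ℚ S.K = S.h := (Embeddings.card S.K ℂ).symm
  rw [h2] at h0
  exact h1.trans h0


/-! ### Integrality helpers -/

/-- Natural numbers are algebraic integers. [folklore] -/
theorem isIntegral_natCast_K (k : ℕ) : IsIntegral ℤ (k : S.K) := by
  exact_mod_cast isIntegral_algebraMap (R := ℤ) (A := S.K) (x := (k : ℤ))

/-- Integers are algebraic integers. [folklore] -/
theorem isIntegral_intCast_K (k : ℤ) : IsIntegral ℤ (k : S.K) := by
  exact_mod_cast isIntegral_algebraMap (R := ℤ) (A := S.K) (x := k)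

/-- `D^m Q(m, a, b, z)` is an algebraic integer when `D b` and `z` are (clear denominators
termwise in Baker's `q(λ₀, λₙ, z)`; cf. the factor `b₀^{m₀}` in `P'`, eq. (6), p. 21).
[cite: Baker1975, Ch. 2 Lemma 2] -/
theorem isIntegral_D_pow_mul_Q (m a : ℕ) {b z : S.K} (hb : IsIntegral ℤ ((S.D : S.K) * b))
    (hz : IsIntegral ℤ z) : IsIntegral ℤ ((S.D : S.K) ^ m * Q m a b z) := by
  unfold Q
  rw [mul_sum]
  refine IsIntegral.sum _ fun μ hμ => ?_
  have hμm : μ ≤ m := Nat.lt_succ_iff.mp (mem_range.mp hμ)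
  have e : (S.D : S.K) ^ m * ((m.choose μ : S.K) * (a.descFactorial μ : S.K) * b ^ (m - μ) *
      z ^ (a - μ)) = (m.choose μ : S.K) * (a.descFactorial μ : S.K) *
        ((S.D : S.K) * b) ^ (m - μ) * (S.D : S.K) ^ μ * z ^ (a - μ) := by
    rw [mul_pow, ← pow_sub_mul_pow (S.D : S.K) hμm]; ring
  rw [e]
  exact ((((S.isIntegral_natCast_K _).mul (S.isIntegral_natCast_K _)).mul (hb.pow _)).mul
    ((S.isIntegral_intCast_K _).pow _)).mul (hz.pow _)

/-! ### The algebraic part of `f_m(l)` -/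

/-- `P_m = ∏ᵣ (log αᵣ)^{mᵣ}` (Baker's `P`, p. 22). [cite: Baker1975, Ch. 2 Lemma 3] -/
def P (m : Fin (S.n + 1) → ℕ) : ℂ := ∏ r : Fin S.n, S.l (Fin.castSucc r) ^ m r.succ

variable (L) in
/-- The algebraic part of one term of `f_m(l)` as an element of `K`:
`Q(m₀, λ₀, λ_N β₀, l) ∏ᵣ γᵣ^{mᵣ} ∏ᵢ αᵢ^{λᵢ l}` (so that `term = P_m · termK`, cf. Baker's
`f(l) = P ∑ p(λ) q(λ₀,λₙ,l) α₁^{λ₁l} ⋯ αₙ^{λₙl} γ₁^{m₁} ⋯`, p. 22). [cite: Baker1975, Ch. 2 Lemma 3] -/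
def termK (u : Idx S.n L) (m : Fin (S.n + 1) → ℕ) (l : ℕ) : S.K :=
  Q (m 0) (u.1 : ℕ) (((u.2 (Fin.last S.n) : ℕ) : S.K) * S.β₀K) (l : S.K) *
    (∏ r : Fin S.n, ((((u.2 (Fin.castSucc r)) : ℕ) : S.K) +
      ((u.2 (Fin.last S.n) : ℕ) : S.K) * S.βK r) ^ m r.succ) *
    ∏ i, S.αK i ^ ((u.2 i : ℕ) * l)

/-- Conjugates of `termK` are `termEval` at the conjugates of the generators. [folklore] -/
theorem map_termK (σ : S.K →+* ℂ) (u : Idx S.n L) (m : Fin (S.n + 1) → ℕ) (l : ℕ) :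
    σ (S.termK L u m l) =
      termEval S.n L (fun i => σ (S.αK i)) (σ S.β₀K) (fun r => σ (S.βK r)) u m l := by
  simp only [termK, termEval, map_mul, map_prod, map_pow, map_add, map_natCast, map_Q]

/-- In `ℂ`, `termK` is `termEval` at the generators themselves. [folklore] -/
theorem algebraMap_termK (u : Idx S.n L) (m : Fin (S.n + 1) → ℕ) (l : ℕ) :
    algebraMap S.K ℂ (S.termK L u m l) = termEval S.n L S.α S.β₀ S.β u m l := by
  rw [S.map_termK]; rfl

/-- `e^{ψ_λ l} = ∏ᵢ αᵢ^{λᵢ l}` for a natural number `l`. [folklore] -/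
theorem cexp_w_mul_nat (v : Fin (S.n + 1) → Fin (L + 1)) (l : ℕ) :
    cexp (S.w v * (l : ℂ)) = ∏ i, S.α i ^ ((v i : ℕ) * l) := by
  unfold w α
  rw [sum_mul, Complex.exp_sum]
  refine prod_congr rfl fun i _ => ?_
  rw [← Complex.exp_nat_mul]
  push_cast
  ring_nf

/-- **`term = P_m · termK` at natural numbers** (Baker 1975, p. 22, the displayed formula for
`f(z)`). [cite: Baker1975, Ch. 2 Lemma 3] -/
theorem term_nat_eq (u : Idx S.n L) (m : Fin (S.n + 1) → ℕ) (l : ℕ) :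
    S.term u m (l : ℂ) = S.P m * termEval S.n L S.α S.β₀ S.β u m l := by
  have hA : S.A u.2 m = (∏ r : Fin S.n, S.γ u.2 r ^ m r.succ) * S.P m := by
    unfold A P
    rw [← prod_mul_distrib]
    exact prod_congr rfl fun r _ => mul_pow _ _ _
  rw [term, hA, S.cexp_w_mul_nat, termEval]
  simp only [bq, γ]
  ring

variable (L) in
/-- The algebraic number `G = ∑_λ p(λ) termK` with `f_m(l) = P_m G` (Baker's `f(l)/P`).
[cite: Baker1975, Ch. 2 Lemma 3] -/
def G (p : Idx S.n L → ℤ) (m : Fin (S.n + 1) → ℕ) (l : ℕ) : S.K :=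
  ∑ u, (p u : S.K) * S.termK L u m l

/-- **`f_m(l) = P_m · G`** for natural numbers `l`. [cite: Baker1975, Ch. 2 Lemma 3] -/
theorem F_nat_eq (p : Idx S.n L → ℤ) (m : Fin (S.n + 1) → ℕ) (l : ℕ) :
    S.F p m (l : ℂ) = S.P m * algebraMap S.K ℂ (S.G L p m l) := by
  unfold F G
  rw [map_sum, mul_sum]
  refine sum_congr rfl fun u _ => ?_
  rw [map_mul, map_intCast, S.algebraMap_termK, S.term_nat_eq]
  ring

/-- The exponent of the denominator: `e = |m| + (n+1) L l` (Baker's `P' = (a₁⋯aₙ)^{Ll} b₀^{m₀}⋯`,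
eq. (6), p. 21). [cite: Baker1975, Ch. 2 Lemma 2, eq. (6)] -/
def eD (n L : ℕ) (m : Fin (n + 1) → ℕ) (l : ℕ) : ℕ := (∑ i, m i) + (n + 1) * (L * l)

/-- **Clearing denominators**: `D^e · termK` is an algebraic integer (Baker 1975, p. 23: "`f'` is
an algebraic integer"). [cite: Baker1975, Ch. 2 Lemma 3] -/
theorem isIntegral_D_pow_mul_termK (u : Idx S.n L) (m : Fin (S.n + 1) → ℕ) (l : ℕ) :
    IsIntegral ℤ ((S.D : S.K) ^ eD S.n L m l * S.termK L u m l) := by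
  -- the three factors
  have h1 : IsIntegral ℤ ((S.D : S.K) ^ m 0 *
      Q (m 0) (u.1 : ℕ) (((u.2 (Fin.last S.n) : ℕ) : S.K) * S.β₀K) (l : S.K)) := by
    refine S.isIntegral_D_pow_mul_Q _ _ ?_ (S.isIntegral_natCast_K l)
    rw [mul_left_comm]
    exact (S.isIntegral_natCast_K _).mul S.isIntegral_D_mul_β₀K
  have h2 : ∀ r : Fin S.n, IsIntegral ℤ ((S.D : S.K) ^ m r.succ *
      ((((u.2 (Fin.castSucc r)) : ℕ) : S.K) + ((u.2 (Fin.last S.n) : ℕ) : S.K) * S.βK r) ^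
        m r.succ) := by
    intro r
    rw [← mul_pow, mul_add, mul_left_comm]
    exact (((S.isIntegral_intCast_K _).mul (S.isIntegral_natCast_K _)).add
      ((S.isIntegral_natCast_K _).mul (S.isIntegral_D_mul_βK r))).pow _
  have h3 : ∀ i, IsIntegral ℤ ((S.D : S.K) ^ (L * l) * S.αK i ^ ((u.2 i : ℕ) * l)) := by
    intro i
    have hv : (u.2 i : ℕ) ≤ L := Nat.lt_succ_iff.mp (u.2 i).isLt
    have e : L * l = (L - (u.2 i : ℕ)) * l + (u.2 i : ℕ) * l := by
      rw [← add_mul, Nat.sub_add_cancel hv]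
    rw [e, pow_add, mul_assoc, ← mul_pow]
    exact ((S.isIntegral_intCast_K _).pow _).mul ((S.isIntegral_D_mul_αK i).pow _)
  -- assemble
  have e : (S.D : S.K) ^ eD S.n L m l * S.termK L u m l =
      ((S.D : S.K) ^ m 0 * Q (m 0) (u.1 : ℕ) (((u.2 (Fin.last S.n) : ℕ) : S.K) * S.β₀K) (l : S.K)) *
      (∏ r : Fin S.n, (S.D : S.K) ^ m r.succ *
        ((((u.2 (Fin.castSucc r)) : ℕ) : S.K) + ((u.2 (Fin.last S.n) : ℕ) : S.K) * S.βK r) ^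
          m r.succ) *
      ∏ i, (S.D : S.K) ^ (L * l) * S.αK i ^ ((u.2 i : ℕ) * l) := by
    rw [prod_mul_distrib, prod_mul_distrib, prod_pow_eq_pow_sum, prod_const, card_univ,
      Fintype.card_fin, ← pow_mul, eD, Fin.sum_univ_succ, pow_add, pow_add, termK]
    ring
  rw [e]
  exact (h1.mul (IsIntegral.prod _ fun r _ => h2 r)).mul (IsIntegral.prod _ fun i _ => h3 i)

/-- **Size of the conjugates of `D^e termK`**: `house(D^e termK) ≤ |D|^e (2LM)^{|m|} l^L M^{(n+1)Ll}`
for `l ≥ 1` (Baker 1975, p. 23). [cite: Baker1975, Ch. 2 Lemma 3] -/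
theorem house_D_pow_mul_termK_le (e : ℕ) (u : Idx S.n L) (m : Fin (S.n + 1) → ℕ) {l : ℕ}
    (hl : 1 ≤ l) :
    house ((S.D : S.K) ^ e * S.termK L u m l) ≤
      |(S.D : ℝ)| ^ e * ((2 * L * S.M) ^ (∑ i, m i) * (l : ℝ) ^ L * S.M ^ ((S.n + 1) * (L * l))) := by
  have hM0 : (0 : ℝ) < S.M := lt_of_lt_of_le one_pos S.one_le_M
  refine S.house_le_of_forall_norm_le (by positivity) fun σ => ?_
  rw [map_mul, map_pow, map_intCast, norm_mul, norm_pow, Complex.norm_intCast, S.map_termK]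
  exact mul_le_mul_of_nonneg_left (norm_termEval_le S.one_le_M (S.norm_embedding_αK_le σ)
    (S.norm_embedding_β₀K_le σ) (S.norm_embedding_βK_le σ) u m hl) (by positivity)

/-! ### Lemma 3, second assertion: the arithmetic lower bound -/

/-- `ℓ⁻ = 1 + ∑ᵣ |log αᵣ|⁻¹`, so that `|log αᵣ| ≥ 1/ℓ⁻` (a constant `c` of the source).
[cite: Baker1975, Ch. 2 Lemma 3] -/
def ℓinv : ℝ := 1 + ∑ r : Fin S.n, ‖S.l (Fin.castSucc r)‖⁻¹

/-- `1 ≤ ℓ⁻`. [folklore] -/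
theorem one_le_ℓinv : 1 ≤ S.ℓinv := by
  have : 0 ≤ ∑ r : Fin S.n, ‖S.l (Fin.castSucc r)‖⁻¹ := by positivity
  unfold ℓinv; linarith

/-- `|P_m| ≥ ℓ⁻^{-|m|}`. [cite: Baker1975, Ch. 2 Lemma 3] -/
theorem norm_P_ge (m : Fin (S.n + 1) → ℕ) : (S.ℓinv ^ (∑ i, m i))⁻¹ ≤ ‖S.P m‖ := by
  have hℓ := S.one_le_ℓinv
  have h1 : (S.ℓinv ^ (∑ i, m i))⁻¹ ≤ (S.ℓinv ^ (∑ r : Fin S.n, m r.succ))⁻¹ := by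
    refine inv_anti₀ (by positivity) (pow_le_pow_right₀ hℓ ?_)
    rw [Fin.sum_univ_succ]; omega
  refine h1.trans ?_
  rw [P, norm_prod, ← inv_pow, ← prod_pow_eq_pow_sum]
  refine prod_le_prod (fun r _ => by positivity) fun r _ => ?_
  rw [norm_pow]
  refine pow_le_pow_left₀ (by positivity) ?_ _
  have h0 : 0 < ‖S.l (Fin.castSucc r)‖ := norm_pos_iff.mpr (S.l_ne_zero _)
  rw [inv_le_comm₀ (by positivity) h0]
  have : ‖S.l (Fin.castSucc r)‖⁻¹ ≤ ∑ r' : Fin S.n, ‖S.l (Fin.castSucc r')‖⁻¹ :=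
    single_le_sum (f := fun r' : Fin S.n => ‖S.l (Fin.castSucc r')‖⁻¹) (fun _ _ => by positivity)
      (mem_univ r)
  unfold ℓinv; linarith

/-- **Baker 1975, Lemma 3, second assertion** (p. 22–23), in the form
`|P_m| ≤ |f_m(l)| · |D|^e · H^{h-1}` whenever `f_m(l) ≠ 0`, where
`H = (L+1)^{n+2} B |D|^e (2LM)^{|m|} l^L M^{(n+1)Ll}` bounds the house of the algebraic integer
`f' = D^e f_m(l)/P_m` and `B ≥ |p(λ)|`: *either `f(l) = 0` or `|f(l)| > c₆^{-h²-Ll}`*.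
The source's proof: the norm of `f'` is a non-zero rational integer. [cite: Baker1975, Ch. 2 Lemma 3] -/
theorem norm_P_le_norm_F_mul (p : Idx S.n L → ℤ) {B : ℝ} (hB : ∀ u, |(p u : ℝ)| ≤ B)
    (m : Fin (S.n + 1) → ℕ) {l : ℕ} (hl : 1 ≤ l) (hne : S.F p m l ≠ 0) :
    ‖S.P m‖ ≤ ‖S.F p m l‖ * (|(S.D : ℝ)| ^ eD S.n L m l *
      (((L + 1 : ℕ) : ℝ) ^ (S.n + 2) * B * (|(S.D : ℝ)| ^ eD S.n L m l *
        ((2 * L * S.M) ^ (∑ i, m i) * (l : ℝ) ^ L * S.M ^ ((S.n + 1) * (L * l))))) ^ (S.h - 1)) := by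
  have hB0 : 0 ≤ B := (abs_nonneg _).trans (hB default)
  set e := eD S.n L m l with he
  -- the algebraic integer `X = D^e G`
  have hXint : IsIntegral ℤ ((S.D : S.K) ^ e * S.G L p m l) := by
    unfold G
    rw [mul_sum]
    refine IsIntegral.sum _ fun u _ => ?_
    rw [mul_left_comm]
    exact (S.isIntegral_intCast_K _).mul (S.isIntegral_D_pow_mul_termK u m l)
  set X : 𝓞 S.K := ⟨(S.D : S.K) ^ e * S.G L p m l, hXint⟩ with hX
  have hFG := S.F_nat_eq p m l
  have hG0 : algebraMap S.K ℂ (S.G L p m l) ≠ 0 := by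
    intro h0; rw [hFG, h0, mul_zero] at hne; exact hne rfl
  have hX0 : X ≠ 0 := by
    intro h0
    have h1 : ((S.D : S.K) ^ e * S.G L p m l : S.K) = 0 := by
      have := congrArg (algebraMap (𝓞 S.K) S.K) h0
      simpa [hX] using this
    rcases mul_eq_zero.mp h1 with h2 | h2
    · exact S.D_ne_zero (by exact_mod_cast pow_eq_zero_iff'.mp h2 |>.1)
    · exact hG0 (by rw [h2, map_zero])
  -- its house
  have hhouse : house (X : S.K) ≤ ((L + 1 : ℕ) : ℝ) ^ (S.n + 2) * B * (|(S.D : ℝ)| ^ e *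
      ((2 * L * S.M) ^ (∑ i, m i) * (l : ℝ) ^ L * S.M ^ ((S.n + 1) * (L * l)))) := by
    have hXK : (X : S.K) = ∑ u, (p u : S.K) * ((S.D : S.K) ^ e * S.termK L u m l) := by
      simp only [hX, RingOfIntegers.map_mk, G, mul_sum]
      exact sum_congr rfl fun u _ => by ring
    rw [hXK]
    calc house (∑ u, (p u : S.K) * ((S.D : S.K) ^ e * S.termK L u m l))
        ≤ ∑ u, house ((p u : S.K) * ((S.D : S.K) ^ e * S.termK L u m l)) :=
          house_sum_le_sum_house _ _
      _ ≤ ∑ _u : Idx S.n L, B * (|(S.D : ℝ)| ^ e *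
          ((2 * L * S.M) ^ (∑ i, m i) * (l : ℝ) ^ L * S.M ^ ((S.n + 1) * (L * l)))) := by
          refine sum_le_sum fun u _ => (house_mul_le _ _).trans ?_
          rw [house_intCast]
          push_cast
          exact mul_le_mul (hB u) (S.house_D_pow_mul_termK_le e u m hl) (house_nonneg _) hB0
      _ = _ := by
          rw [sum_const, card_univ, card_Idx, nsmul_eq_mul]; push_cast; ring
  -- the norm inequality
  have hmain := S.one_le_norm_mul_house_pow hX0
  have hXC : ((X : S.K) : ℂ) = (S.D : ℂ) ^ e * algebraMap S.K ℂ (S.G L p m l) := by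
    simp only [hX, RingOfIntegers.map_mk]
    change algebraMap S.K ℂ ((S.D : S.K) ^ e * S.G L p m l) = _
    rw [map_mul, map_pow, map_intCast]
  have hnormX : ‖((X : S.K) : ℂ)‖ = |(S.D : ℝ)| ^ e * ‖algebraMap S.K ℂ (S.G L p m l)‖ := by
    rw [hXC, norm_mul, norm_pow, Complex.norm_intCast]
  have hh1 : house (X : S.K) ^ (S.h - 1) ≤ (((L + 1 : ℕ) : ℝ) ^ (S.n + 2) * B * (|(S.D : ℝ)| ^ e *
      ((2 * L * S.M) ^ (∑ i, m i) * (l : ℝ) ^ L * S.M ^ ((S.n + 1) * (L * l))))) ^ (S.h - 1) :=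
    pow_le_pow_left₀ (house_nonneg _) hhouse _
  have hnormF : ‖S.F p m l‖ = ‖S.P m‖ * ‖algebraMap S.K ℂ (S.G L p m l)‖ := by
    rw [hFG, norm_mul]
  calc ‖S.P m‖ = ‖S.P m‖ * 1 := (mul_one _).symm
    _ ≤ ‖S.P m‖ * (‖((X : S.K) : ℂ)‖ * house (X : S.K) ^ (S.h - 1)) :=
        mul_le_mul_of_nonneg_left hmain (norm_nonneg _)
    _ ≤ ‖S.P m‖ * (‖((X : S.K) : ℂ)‖ * (((L + 1 : ℕ) : ℝ) ^ (S.n + 2) * B * (|(S.D : ℝ)| ^ e *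
        ((2 * L * S.M) ^ (∑ i, m i) * (l : ℝ) ^ L * S.M ^ ((S.n + 1) * (L * l))))) ^ (S.h - 1)) := by
        gcongr
    _ = _ := by rw [hnormX, hnormF]; ring


/-! ### Lemma 2: the coefficients `p(λ)` from Siegel's lemma -/

section Siegel

variable (L : ℕ) (P₀ D₀ : ℕ)

/-- The uniform denominator exponent `e₀ = (n+1) D₀ + (n+1) L P₀ ≥ e` used for all equations of
the Siegel system. [cite: Baker1975, Ch. 2 Lemma 2, eq. (6)] -/
def e₀ : ℕ := (S.n + 1) * D₀ + (S.n + 1) * (L * P₀)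

/-- `e ≤ e₀` on the relevant range. [folklore] -/
theorem eD_le_e₀ {m : Fin (S.n + 1) → ℕ} (hm : ∀ i, m i ≤ D₀) {l : ℕ} (hl : l ≤ P₀) :
    eD S.n L m l ≤ S.e₀ L P₀ D₀ := by
  unfold eD e₀
  have h1 : ∑ i, m i ≤ (S.n + 1) * D₀ :=
    (sum_le_sum fun i _ => hm i).trans (by simp)
  have h2 : (S.n + 1) * (L * l) ≤ (S.n + 1) * (L * P₀) :=
    Nat.mul_le_mul_left _ (Nat.mul_le_mul_left _ hl)
  omega

/-- The algebraic integers `X(λ; l, m) = D^{e₀} termK` whose integer coordinates are the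
coefficients of the Siegel system (Baker's `A(s,t)`-equations, p. 21, with the spanning family
`α^s β^t` replaced by an integral basis of `K`). [cite: Baker1975, Ch. 2 Lemma 2] -/
def XO (u : Idx S.n L) (m : Fin (S.n + 1) → Fin (D₀ + 1)) (l : Fin P₀) : 𝓞 S.K :=
  ⟨(S.D : S.K) ^ S.e₀ L P₀ D₀ * S.termK L u (fun i => (m i : ℕ)) ((l : ℕ) + 1), by
    have hle : eD S.n L (fun i => (m i : ℕ)) ((l : ℕ) + 1) ≤ S.e₀ L P₀ D₀ :=
      S.eD_le_e₀ L P₀ D₀ (fun i => Nat.lt_succ_iff.mp (m i).isLt) l.isLt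
    rw [← Nat.sub_add_cancel hle, pow_add, mul_assoc]
    exact ((S.isIntegral_intCast_K _).pow _).mul (S.isIntegral_D_pow_mul_termK u _ _)⟩

/-- The integer matrix of the Siegel system: rows `(l, m, i)` (`i` an integral-basis coordinate),
columns `λ`, entries `coordᵢ X(λ; l, m)`. [cite: Baker1975, Ch. 2 Lemma 2] -/
def sMat : Matrix (Fin P₀ × (Fin (S.n + 1) → Fin (D₀ + 1)) × (S.K →+* ℂ)) (Idx S.n L) ℤ :=
  Matrix.of fun ρ u => S.bO.repr (S.XO L P₀ D₀ u ρ.2.1 ρ.1) ρ.2.2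

/-- **Baker 1975, Ch. 2, Lemma 2** (p. 21), for general parameters: if
`(L+1)^{n+2} ≥ 2 · P₀ (D₀+1)^{n+1} h` then there are integers `p(λ)`, `λ ∈ [0,L]^{n+2}`, not all
zero, with `|p(λ)| ≤ (L+1)^{n+2} c_K |D|^{e₀} (2LM)^{(n+1)D₀} P₀^L M^{(n+1)LP₀}` (the source:
`≤ e^{h²}` for its parameters), such that `f_m(l) = F p m l = 0` for all integers `1 ≤ l ≤ P₀` and
all `m` with every `mᵢ ≤ D₀` (in particular all `|m| ≤ D₀`). Proof as in the source: the
vanishing is implied by integer linear equations (coordinates of `D^{e₀} G` in an integral basis),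
solved by Siegel's lemma (`Baker1975.lemma1` / Mathlib). [cite: Baker1975, Ch. 2 Lemma 2] -/
theorem lemma2 (hP : 0 < P₀)
    (hcard : 2 * (P₀ * (D₀ + 1) ^ (S.n + 1) * S.h) ≤ (L + 1) ^ (S.n + 2)) :
    ∃ p : Idx S.n L → ℤ, p ≠ 0 ∧
      (∀ u, |(p u : ℝ)| ≤ ((L + 1 : ℕ) : ℝ) ^ (S.n + 2) * (S.cK * (|(S.D : ℝ)| ^ S.e₀ L P₀ D₀ *
        ((2 * L * S.M) ^ ((S.n + 1) * D₀) * (P₀ : ℝ) ^ L * S.M ^ ((S.n + 1) * (L * P₀)))))) ∧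
      ∀ l : ℕ, 1 ≤ l → l ≤ P₀ → ∀ m : Fin (S.n + 1) → ℕ, (∀ i, m i ≤ D₀) → S.F p m l = 0 := by
  classical
  letI : SeminormedAddCommGroup
      (Matrix (Fin P₀ × (Fin (S.n + 1) → Fin (D₀ + 1)) × (S.K →+* ℂ)) (Idx S.n L) ℤ) :=
    Matrix.seminormedAddCommGroup
  set A := S.sMat L P₀ D₀ with hA
  have hM1 := S.one_le_M
  have hcK := S.one_le_cK
  have hD1 := S.one_le_abs_D
  have hh := S.one_le_h
  -- cardinalities
  have hrows : Fintype.card (Fin P₀ × (Fin (S.n + 1) → Fin (D₀ + 1)) × (S.K →+* ℂ)) =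
      P₀ * (D₀ + 1) ^ (S.n + 1) * S.h := by
    simp only [Fintype.card_prod, Fintype.card_fun, Fintype.card_fin, h]; ring
  have hcols : Fintype.card (Idx S.n L) = (L + 1) ^ (S.n + 2) := card_Idx _ _
  have hrowpos : 0 < P₀ * (D₀ + 1) ^ (S.n + 1) * S.h := by positivity
  have hL1 : 1 ≤ L := by
    rcases Nat.eq_zero_or_pos L with h0 | h0
    · subst h0; simp at hcard; omega
    · exact h0
  obtain ⟨t, ht0, hAt, hnorm⟩ := Int.Matrix.exists_ne_zero_int_vec_norm_le A
    (by rw [hrows, hcols]; omega) (by rw [hrows]; exact hrowpos)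
  rw [hrows, hcols] at hnorm
  -- the entry bound
  set U : ℝ := S.cK * (|(S.D : ℝ)| ^ S.e₀ L P₀ D₀ *
    ((2 * L * S.M) ^ ((S.n + 1) * D₀) * (P₀ : ℝ) ^ L * S.M ^ ((S.n + 1) * (L * P₀)))) with hU
  have hLM1 : (1 : ℝ) ≤ 2 * L * S.M := by
    have : (1 : ℝ) ≤ L := by exact_mod_cast hL1
    nlinarith
  have hP1 : (1 : ℝ) ≤ P₀ := by exact_mod_cast hP
  have hU1 : 1 ≤ U := by
    have h1 : (1 : ℝ) ≤ |(S.D : ℝ)| ^ S.e₀ L P₀ D₀ := one_le_pow₀ hD1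
    have h2 : (1 : ℝ) ≤ (2 * L * S.M) ^ ((S.n + 1) * D₀) := one_le_pow₀ hLM1
    have h3 : (1 : ℝ) ≤ (P₀ : ℝ) ^ L := one_le_pow₀ hP1
    have h4 : (1 : ℝ) ≤ S.M ^ ((S.n + 1) * (L * P₀)) := one_le_pow₀ hM1
    rw [hU]
    calc (1 : ℝ) = 1 * (1 * (1 * 1 * 1)) := by ring
      _ ≤ S.cK * (|(S.D : ℝ)| ^ S.e₀ L P₀ D₀ *
          ((2 * L * S.M) ^ ((S.n + 1) * D₀) * (P₀ : ℝ) ^ L * S.M ^ ((S.n + 1) * (L * P₀)))) := by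
          gcongr
  have hentry : ∀ ρ u, |(A ρ u : ℝ)| ≤ U := by
    rintro ⟨l, m, i⟩ u
    have hl1 : 1 ≤ (l : ℕ) + 1 := Nat.succ_pos _
    have hb := S.abs_repr_le (S.XO L P₀ D₀ u m l) i
    simp only [hA, sMat, Matrix.of_apply]
    refine hb.trans ?_
    rw [hU]
    refine mul_le_mul_of_nonneg_left ?_ (by linarith)
    have hX : (algebraMap (𝓞 S.K) S.K (S.XO L P₀ D₀ u m l)) =
        (S.D : S.K) ^ S.e₀ L P₀ D₀ * S.termK L u (fun i => (m i : ℕ)) ((l : ℕ) + 1) := rfl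
    rw [hX]
    refine (S.house_D_pow_mul_termK_le _ u _ hl1).trans ?_
    refine mul_le_mul_of_nonneg_left ?_ (by positivity)
    have hM0 : (0 : ℝ) < S.M := by linarith
    have e1 : (2 * L * S.M) ^ (∑ i, ((m i : ℕ))) ≤ (2 * L * S.M) ^ ((S.n + 1) * D₀) := by
      refine pow_le_pow_right₀ hLM1 ?_
      exact (sum_le_sum fun i _ => Nat.lt_succ_iff.mp (m i).isLt).trans (by simp)
    have e2 : ((((l : ℕ) + 1 : ℕ) : ℝ)) ^ L ≤ (P₀ : ℝ) ^ L := by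
      refine pow_le_pow_left₀ (by positivity) ?_ _
      exact_mod_cast l.isLt
    have e3 : S.M ^ ((S.n + 1) * (L * ((l : ℕ) + 1))) ≤ S.M ^ ((S.n + 1) * (L * P₀)) := by
      refine pow_le_pow_right₀ hM1 (Nat.mul_le_mul_left _ (Nat.mul_le_mul_left _ ?_))
      exact l.isLt
    push_cast at e2 ⊢
    exact mul_le_mul (mul_le_mul e1 e2 (by positivity) (by positivity)) e3 (by positivity)
      (by positivity)
  have hAnorm : ‖A‖ ≤ U := by
    rw [Matrix.norm_le_iff (by linarith)]
    intro ρ u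
    rw [Int.norm_eq_abs]
    exact_mod_cast hentry ρ u
  -- the bound for `t`
  have hcols1 : (1 : ℝ) ≤ (((L + 1) ^ (S.n + 2) : ℕ) : ℝ) := by
    exact_mod_cast Nat.one_le_pow _ _ (Nat.succ_pos L)
  have hbase1 : (1 : ℝ) ≤ (((L + 1) ^ (S.n + 2) : ℕ) : ℝ) * max 1 ‖A‖ :=
    one_le_mul_of_one_le_of_one_le hcols1 (le_max_left _ _)
  have hexp : ((P₀ * (D₀ + 1) ^ (S.n + 1) * S.h : ℕ) : ℝ) /
      ((((L + 1) ^ (S.n + 2) : ℕ) : ℝ) - ((P₀ * (D₀ + 1) ^ (S.n + 1) * S.h : ℕ) : ℝ)) ≤ 1 := by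
    have h2 : (2 : ℝ) * ((P₀ * (D₀ + 1) ^ (S.n + 1) * S.h : ℕ) : ℝ) ≤
        (((L + 1) ^ (S.n + 2) : ℕ) : ℝ) := by exact_mod_cast hcard
    have hpos : (0 : ℝ) < ((P₀ * (D₀ + 1) ^ (S.n + 1) * S.h : ℕ) : ℝ) := by exact_mod_cast hrowpos
    rw [div_le_one (by linarith)]
    linarith
  have htu : ∀ u, |(t u : ℝ)| ≤ (((L + 1) ^ (S.n + 2) : ℕ) : ℝ) * U := by
    intro u
    calc |(t u : ℝ)| = ‖t u‖ := (Int.norm_eq_abs _).symm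
      _ ≤ ‖t‖ := norm_le_pi_norm t u
      _ ≤ _ := hnorm
      _ ≤ ((((L + 1) ^ (S.n + 2) : ℕ) : ℝ) * max 1 ‖A‖) ^ (1 : ℝ) :=
          Real.rpow_le_rpow_of_exponent_le hbase1 hexp
      _ = (((L + 1) ^ (S.n + 2) : ℕ) : ℝ) * max 1 ‖A‖ := Real.rpow_one _
      _ ≤ (((L + 1) ^ (S.n + 2) : ℕ) : ℝ) * U :=
          mul_le_mul_of_nonneg_left (max_le hU1 hAnorm) (by positivity)
  refine ⟨t, ht0, fun u => ?_, ?_⟩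
  · have := htu u
    push_cast at this ⊢
    exact this
  -- the vanishing
  intro l hl1 hlP m hm
  set ρl : Fin P₀ := ⟨l - 1, by omega⟩ with hρl
  set ρm : Fin (S.n + 1) → Fin (D₀ + 1) := fun i => ⟨m i, Nat.lt_succ_iff.mpr (hm i)⟩ with hρm
  have hml : (fun i => ((ρm i : Fin (D₀ + 1)) : ℕ)) = m := by funext i; rfl
  have hll : (ρl : ℕ) + 1 = l := by simp [hρl]; omega
  -- the combination `∑ t(λ) X(λ)` vanishes in `𝓞 K`
  have hcomb : ∑ u, (t u : 𝓞 S.K) * S.XO L P₀ D₀ u ρm ρl = 0 := by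
    apply S.bO.repr.injective
    rw [map_zero]
    ext i
    have hi := congrFun hAt (ρl, ρm, i)
    simp only [Matrix.mulVec, dotProduct, Pi.zero_apply, hA, sMat, Matrix.of_apply] at hi
    rw [map_sum, Finsupp.coe_finsetSum, Finset.sum_apply, Finsupp.coe_zero, Pi.zero_apply, ← hi]
    refine sum_congr rfl fun u _ => ?_
    rw [← zsmul_eq_mul, LinearEquiv.map_smul, Finsupp.coe_smul, Pi.smul_apply, smul_eq_mul,
      mul_comm]
  -- hence in `ℂ`
  have hcombC : (S.D : ℂ) ^ S.e₀ L P₀ D₀ * algebraMap S.K ℂ (S.G L t m l) = 0 := by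
    have h1 := congrArg (fun x : 𝓞 S.K => algebraMap S.K ℂ (algebraMap (𝓞 S.K) S.K x)) hcomb
    simp only [map_sum, map_mul, map_zero] at h1
    rw [G, map_sum, mul_sum, ← h1]
    refine sum_congr rfl fun u _ => ?_
    have e1 : algebraMap (𝓞 S.K) S.K (S.XO L P₀ D₀ u ρm ρl) =
        (S.D : S.K) ^ S.e₀ L P₀ D₀ * S.termK L u m l := by
      rw [← hml, ← hll]; rfl
    have e2 : algebraMap (𝓞 S.K) S.K (t u : 𝓞 S.K) = (t u : S.K) := map_intCast _ _
    rw [e1, e2, map_mul, map_mul, map_pow, map_intCast, map_intCast]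
    ring
  have hG0 : algebraMap S.K ℂ (S.G L t m l) = 0 := by
    rcases mul_eq_zero.mp hcombC with h0 | h0
    · exact absurd (pow_eq_zero_iff'.mp h0).1 (by exact_mod_cast S.D_ne_zero)
    · exact h0
  rw [S.F_nat_eq, hG0, mul_zero]

end Siegel

end Setup

end Literature.NumberTheory.Transcendental.Baker1975
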